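import Literature.NumberTheory.IwasawaTheory.FukudaNakayamaFinite
import Mathlib.LinearAlgebra.Quotient.Basic
import Mathlib.LinearAlgebra.Quotient.Card
import Mathlib.LinearAlgebra.Isomorphisms
import HarnessLib

/-!
# Fukuda's Theorem 1 (2) at finite level — the elementary module algebra behind the `μ = 0` rider
# («`μ = 0` iff the `p`-ranks are bounded», finite shadow): unipotence modulo `p`, `ν Y = pY`, and `#(pY)² ≤ #Y`

Topic `NumberTheory/IwasawaTheory` (namespace = path). THEOREM-ONLY file (no definition, no named fact, no `sorry`), written by the
prover seat `bsd-potss-k8t-c4` g20 (cell `bsd-potss`; Fukuda road of stmt-BirchSwinnertonDyer-19982; closes nothing). Companion of brick (N)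
`FukudaNakayamaFinite.lean`; used by the growth step of the finite-level proof of `fukuda1994_thm1_classGroupPRank_const_of_succ_eq`
(`ClassicalMuInvariant.lean` §5), whose printed rider «in particular `μ_p(K/k) = 0`» rests on «`μ = 0` iff `rank A_n` is bounded» (Washington
§13.3, proof of Prop. 13.23; Lang Ch. 5 §1 Thm. 1.2).  Here everything is a statement about a FINITE abelian `p`-group `M` (a `ℤ`-module),
an endomorphism `φ` of `M`, and the multiplication-by-`p` map `π = p·1` (we write `pW = W.map π`):

* §1 `exists_X_add_one_pow_prime_pow_eq` — `(X + 1)^{p^a} = X^{p^a} + 1 + p·R(X)` in `ℤ[X]`; hence on a module killed by `p`,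
  `ψ^{p^a} = 1 ⇔ (ψ − 1)^{p^a} = 0` (`sub_one_pow_apply_eq_zero`, `pow_apply_eq_self_of_sub_one_pow_eq_zero`);
* §2 `pow_apply_eq_zero_of_card_le` — a nilpotent endomorphism `N` of a `p`-group kills every `N`-stable subgroup of order `≤ p^d` in `d` steps
  (the strictly decreasing chain `W ⊋ NW ⊋ N²W ⊋ ⋯`);
* §3 `card_quotient_range_smul_le` — `#(W/pW) ≤ #(M/pM)` for `W ≤ M` (both equal the number of `p`-torsion elements);
* §4 `sub_one_apply_mem_map_of_card_le` — UNIPOTENCE MOD `p`: if `φ^{p^t} = 1`, `#(M/pM) ≤ p^r`, `r ≤ p^{k₀}`, then `(φ^{p^{k₀}} − 1)W ⊆ pW` for every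
  `φ`-stable `W`;
* §5 `sub_one_apply_mem_map_map_of` — `(φ^{p^j} − 1)W ⊆ pW ⇒ (φ^{p^{j+1}} − 1)W ⊆ p²W` (and `(φ^{p^{j}·i} − 1)W` stays there);
  `map_geom_sum_eq_map_smul` — `(ψ − 1)W ⊆ p²W ⇒ (1 + ψ + ⋯ + ψ^{p−1})W = pW`;
* §6 `card_map_smul_sq_le` — `p²W = 0 ⇒ #(pW)² ≤ #W`.

References: [Washington1997] L. Washington, *Introduction to Cyclotomic Fields*, 2nd ed., §13.3 (Lemma 13.16, Prop. 13.23 and its proof);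
[Lang1990] S. Lang, *Cyclotomic Fields I and II*, Ch. 5 §1 Thm. 1.2; [Fukuda1994] T. Fukuda, Proc. Japan Acad. 70 A (1994), Thm. 1 (2), p. 264.
-/

noncomputable section

open Polynomial Finset

namespace Literature.NumberTheory.IwasawaTheory.FukudaNakayama

/-! ## §1 `(X + 1)^{p^a} ≡ X^{p^a} + 1 (mod p)` and its consequences on modules killed by `p` -/

/-- **`(X + 1)^{p^a} = X^{p^a} + 1 + p·R(X)` in `ℤ[X]`** for some `R` (reduce modulo `p`: Frobenius in `𝔽_p[X]`).
[cite: Washington1997, §13.3 Lemma 13.16 (proof: binomial coefficients `≡ 0 mod p`)] -/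
theorem exists_X_add_one_pow_prime_pow_eq (p a : ℕ) [hp : Fact p.Prime] :
    ∃ R : ℤ[X], (X + 1 : ℤ[X]) ^ (p ^ a) = X ^ (p ^ a) + 1 + C (p : ℤ) * R := by
  set f : ℤ[X] := (X + 1) ^ (p ^ a) - (X ^ (p ^ a) + 1) with hf
  have hmap : f.map (Int.castRingHom (ZMod p)) = 0 := by
    rw [hf, Polynomial.map_sub, Polynomial.map_pow, Polynomial.map_add, Polynomial.map_add, Polynomial.map_pow,
      Polynomial.map_X, Polynomial.map_one, add_pow_char_pow, one_pow, sub_self]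
  have hdvd : C (p : ℤ) ∣ f := by
    rw [C_dvd_iff_dvd_coeff]
    intro i
    have hi : (Int.castRingHom (ZMod p)) (f.coeff i) = 0 := by
      rw [← Polynomial.coeff_map, hmap, coeff_zero]
    exact (ZMod.intCast_zmod_eq_zero_iff_dvd _ _).mp hi
  obtain ⟨R, hR⟩ := hdvd
  refine ⟨R, ?_⟩
  rw [← hR, hf]
  ring

/-- On a module killed by `p`: `((N + 1)^{p^a}) v = (N^{p^a}) v + v` for every endomorphism `N`.
[cite: Washington1997, §13.3 Lemma 13.16 (proof)] -/
theorem add_one_pow_prime_pow_apply {V : Type*} [AddCommGroup V] (p a : ℕ) [Fact p.Prime]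
    (hV : ∀ v : V, (p : ℤ) • v = 0) (N : Module.End ℤ V) (v : V) :
    ((N + 1) ^ (p ^ a)) v = (N ^ (p ^ a)) v + v := by
  obtain ⟨R, hR⟩ := exists_X_add_one_pow_prime_pow_eq p a
  have h := congrArg (aeval N) hR
  rw [map_pow, map_add, aeval_X, map_one, map_add, map_add, map_pow, aeval_X, map_one, map_mul, aeval_C,
    algebraMap_int_eq, eq_intCast] at h
  rw [h, LinearMap.add_apply, LinearMap.add_apply, Module.End.one_apply, Module.End.mul_apply, Module.End.intCast_apply, hV,
    add_zero]

/-- On a module killed by `p`: `ψ^{p^a} = 1 ⇒ ((ψ − 1)^{p^a}) v = 0`. [cite: Washington1997, §13.3 Lemma 13.16 (proof)] -/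
theorem sub_one_pow_apply_eq_zero {V : Type*} [AddCommGroup V] (p a : ℕ) [Fact p.Prime]
    (hV : ∀ v : V, (p : ℤ) • v = 0) (ψ : Module.End ℤ V) (hψ : ψ ^ (p ^ a) = 1) (v : V) :
    ((ψ - 1) ^ (p ^ a)) v = 0 := by
  have h := add_one_pow_prime_pow_apply p a hV (ψ - 1) v
  rw [sub_add_cancel, hψ, Module.End.one_apply] at h
  have h2 : ((ψ - 1) ^ (p ^ a)) v + v = 0 + v := by rw [← h, zero_add]
  exact add_right_cancel h2

/-- On a module killed by `p`: `(ψ − 1)^{p^a} v = 0` for all `v` ⇒ `ψ^{p^a} v = v`. [cite: Washington1997, §13.3 Lemma 13.16 (proof)] -/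
theorem pow_apply_eq_self_of_sub_one_pow_apply_eq_zero {V : Type*} [AddCommGroup V] (p a : ℕ) [Fact p.Prime]
    (hV : ∀ v : V, (p : ℤ) • v = 0) (ψ : Module.End ℤ V) (h : ∀ v, ((ψ - 1) ^ (p ^ a)) v = 0) (v : V) :
    (ψ ^ (p ^ a)) v = v := by
  have h1 := add_one_pow_prime_pow_apply p a hV (ψ - 1) v
  rw [sub_add_cancel, h v, zero_add] at h1
  exact h1

/-! ## §2 A nilpotent endomorphism of a `p`-group of order `≤ p^d` vanishes in `d` steps on it -/

/-- **The chain `W ⊋ NW ⊋ N²W ⊋ ⋯`**: let `M` be a finite abelian group of `p`-power order, `N` an endomorphism with `N^K = 0` for some `K`, and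
`W ≤ M` an `N`-stable subgroup with `#W ≤ p^d`. Then `N^d W = 0` (each proper step of the chain divides the order by at least `p`).
[cite: Washington1997, §13.3 (proof of Prop. 13.23: `rank` bounded ⇒ `μ = 0`)] [cite: Lang1990, Ch. 5 §1 Thm. 1.2] -/
theorem pow_apply_eq_zero_of_card_le {M : Type*} [AddCommGroup M] [Finite M] {p : ℕ} [hp : Fact p.Prime]
    (hM : ∃ a : ℕ, Nat.card M = p ^ a) (N : Module.End ℤ M) (hN : ∃ K : ℕ, N ^ K = 0) :
    ∀ (d : ℕ) (W : Submodule ℤ M), (∀ w ∈ W, N w ∈ W) → Nat.card W ≤ p ^ d → ∀ w ∈ W, (N ^ d) w = 0 := by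
  obtain ⟨K, hK⟩ := hN
  -- every subgroup has `p`-power order
  have hpow : ∀ W : Submodule ℤ M, ∃ b : ℕ, Nat.card W = p ^ b := by
    intro W
    obtain ⟨a, ha⟩ := hM
    have hdvd : Nat.card W ∣ p ^ a := by
      rw [← ha]; exact AddSubgroup.card_addSubgroup_dvd_card W.toAddSubgroup
    obtain ⟨b, -, hb⟩ := (Nat.dvd_prime_pow hp.out).mp hdvd
    exact ⟨b, hb⟩
  -- a stable subgroup with `NW = W` is trivial
  have htriv : ∀ W : Submodule ℤ M, (∀ w ∈ W, N w ∈ W) → W.map N = W → W = ⊥ := by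
    intro W _ hWN
    have hiter : ∀ k : ℕ, W.map (N ^ k) = W := by
      intro k
      induction k with
      | zero => rw [pow_zero, Module.End.one_eq_id, Submodule.map_id]
      | succ k ih => rw [pow_succ, Module.End.mul_eq_comp, Submodule.map_comp, hWN, ih]
    have h := hiter K
    rw [hK, Submodule.map_zero] at h
    exact h.symm
  intro d
  induction d with
  | zero =>
    intro W _ hcard w hw
    rw [pow_zero] at hcard ⊢
    rw [Module.End.one_apply]
    by_contra hne
    have : Nontrivial W := ⟨⟨⟨w, hw⟩, 0, fun h => hne (congrArg Subtype.val h)⟩⟩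
    have h1 := (Finite.one_lt_card_iff_nontrivial (α := W)).mpr this
    omega
  | succ d ih =>
    intro W hW hcard w hw
    by_cases hWN : W.map N = W
    · rw [htriv W hW hWN] at hw
      rw [(Submodule.mem_bot ℤ).mp hw, map_zero]
    · -- `NW < W`, so `#NW ≤ p^d`
      have hle : W.map N ≤ W := Submodule.map_le_iff_le_comap.mpr fun x hx => hW x hx
      have hlt : W.map N < W := lt_of_le_of_ne hle hWN
      obtain ⟨b, hb⟩ := hpow W
      obtain ⟨b', hb'⟩ := hpow (W.map N)
      have hdvd : Nat.card ↥(W.map N) ∣ Nat.card W := AddSubgroup.card_dvd_of_le (show (W.map N).toAddSubgroup ≤ W.toAddSubgroup from hle)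
      have hne : Nat.card ↥(W.map N) ≠ Nat.card W := by
        intro heq
        apply hWN
        exact SetLike.coe_injective (Set.Finite.eq_of_subset_of_card_le (Set.toFinite _) hle (le_of_eq heq.symm))
      have hb'lt : b' < b := by
        rw [hb, hb'] at hdvd hne
        have := (Nat.pow_dvd_pow_iff_le_right hp.out.one_lt).mp hdvd
        rcases this.lt_or_eq with h | h
        · exact h
        · exact absurd (by rw [h]) hne
      have hcard' : Nat.card ↥(W.map N) ≤ p ^ d := by
        rw [hb']
        rw [hb] at hcard
        have hbd : b ≤ d + 1 := (Nat.pow_le_pow_iff_right hp.out.one_lt).mp hcard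
        exact Nat.pow_le_pow_right hp.out.pos (by omega)
      have hstab' : ∀ w ∈ W.map N, N w ∈ W.map N := fun w hw => Submodule.mem_map_of_mem (hle hw)
      rw [pow_succ, Module.End.mul_apply]
      exact ih (W.map N) hstab' hcard' (N w) (Submodule.mem_map_of_mem hw)

/-! ## §3 `#(W/pW) ≤ #(M/pM)`: both count the `p`-torsion -/

/-- **`#(X / pX) = #X[p]`** for a finite `ℤ`-module `X` (`pX` = range, `X[p]` = kernel of multiplication by `p`). [folklore]
[cite: Washington1997, §13.3 (proof of Prop. 13.23)] -/
theorem card_quotient_range_smul_eq_card_ker {X : Type*} [AddCommGroup X] [Finite X] (p : ℕ) :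
    Nat.card (X ⧸ LinearMap.range ((p : ℤ) • (1 : Module.End ℤ X))) = Nat.card (LinearMap.ker ((p : ℤ) • (1 : Module.End ℤ X))) := by
  set π : Module.End ℤ X := (p : ℤ) • 1 with hπ
  have h1 := Submodule.card_eq_card_quotient_mul_card (LinearMap.ker π)
  have h2 := Submodule.card_eq_card_quotient_mul_card (LinearMap.range π)
  rw [Nat.card_congr (LinearMap.quotKerEquivRange π).toEquiv] at h1
  rw [mul_comm] at h2
  have hpos : 0 < Nat.card (LinearMap.range π) := Nat.card_pos
  exact Nat.eq_of_mul_eq_mul_right hpos (h2.symm.trans h1)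

/-- **`#(W/pW) ≤ #(M/pM)` for a subgroup `W ≤ M`** of a finite abelian group (the `p`-torsion of `W` embeds into that of `M`): the
`p`-rank of a subgroup is at most the `p`-rank of the group. [folklore] [cite: Washington1997, §13.3 (proof of Prop. 13.23)] -/
theorem card_quotient_range_smul_le {M : Type*} [AddCommGroup M] [Finite M] (p : ℕ) (W : Submodule ℤ M) :
    Nat.card (W ⧸ LinearMap.range ((p : ℤ) • (1 : Module.End ℤ W))) ≤
      Nat.card (M ⧸ LinearMap.range ((p : ℤ) • (1 : Module.End ℤ M))) := by
  rw [card_quotient_range_smul_eq_card_ker, card_quotient_range_smul_eq_card_ker]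
  let f : LinearMap.ker ((p : ℤ) • (1 : Module.End ℤ W)) → LinearMap.ker ((p : ℤ) • (1 : Module.End ℤ M)) :=
    fun x => ⟨(x.1 : M), by
      have hx := x.2
      rw [LinearMap.mem_ker, LinearMap.smul_apply, Module.End.one_apply] at hx ⊢
      have := congrArg (fun y : W => (y : M)) hx
      simpa using this⟩
  have hf : Function.Injective f := by
    intro x y h
    apply Subtype.ext; apply Subtype.ext
    exact congrArg (fun z : LinearMap.ker ((p : ℤ) • (1 : Module.End ℤ M)) => (z : M)) h
  exact Nat.card_le_card_of_injective f hf

/-! ## §4 Unipotence modulo `p` -/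

/-- **UNIPOTENCE MOD `p`.** Let `M` be a finite abelian group of order `p^a`, `φ` an endomorphism with `φ^{p^t} = 1`, and suppose
`#(M/pM) ≤ p^r` and `r ≤ p^{k₀}`. Then for every `φ`-stable subgroup `W`: `(φ^{p^{k₀}} − 1)W ⊆ pW`.  (On `W/pW`, an `𝔽_p`-space of dimension
`≤ r`, `φ − 1` is nilpotent since `(φ − 1)^{p^t} = φ^{p^t} − 1 = 0`; by §2 `(φ − 1)^r = 0`, so `(φ − 1)^{p^{k₀}} = 0`, i.e. `φ^{p^{k₀}} = 1` there.)
[cite: Washington1997, §13.3 (proof of Prop. 13.23)] [cite: Fukuda1994, Thm. 1 (2), p. 264] -/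
theorem sub_one_apply_mem_map_of_card_le {M : Type*} [AddCommGroup M] [Finite M] {p : ℕ} [hp : Fact p.Prime]
    (hM : ∃ a : ℕ, Nat.card M = p ^ a) (φ : Module.End ℤ M) {t : ℕ} (hφ : φ ^ (p ^ t) = 1)
    {r k₀ : ℕ} (hr : Nat.card (M ⧸ LinearMap.range ((p : ℤ) • (1 : Module.End ℤ M))) ≤ p ^ r) (hk₀ : r ≤ p ^ k₀)
    (W : Submodule ℤ M) (hW : ∀ w ∈ W, φ w ∈ W) :
    ∀ w ∈ W, (φ ^ (p ^ k₀) - 1) w ∈ W.map ((p : ℤ) • (1 : Module.End ℤ M)) := by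
  classical
  -- `X = W` as a module, `φ_X` the restriction, `Q = pX`, `V = X/Q`, `φ̄` the induced map
  set φX : Module.End ℤ W := φ.restrict hW with hφX
  set πX : Module.End ℤ W := (p : ℤ) • 1 with hπX
  set Q : Submodule ℤ W := LinearMap.range πX with hQ
  have hQφ : Q ≤ Q.comap φX := by
    rintro _ ⟨x, rfl⟩
    rw [Submodule.mem_comap, hQ]
    refine ⟨φX x, ?_⟩
    rw [hπX, LinearMap.smul_apply, LinearMap.smul_apply, Module.End.one_apply, Module.End.one_apply, map_zsmul]
  -- the induced endomorphism of `V = X/Q`, as an element of `Module.End ℤ (X ⧸ Q)` characterised pointwise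
  obtain ⟨φV, hφV⟩ : ∃ φV : Module.End ℤ (W ⧸ Q), ∀ x : W, φV (Submodule.Quotient.mk x) = Submodule.Quotient.mk (φX x) :=
    ⟨Q.mapQ Q φX hQφ, fun _ => rfl⟩
  -- `V` is killed by `p`
  have hV : ∀ v : W ⧸ Q, (p : ℤ) • v = 0 := by
    intro v
    obtain ⟨x, rfl⟩ := Submodule.Quotient.mk_surjective Q v
    have h1 : ((p : ℤ) • Submodule.Quotient.mk x : W ⧸ Q) = Submodule.Quotient.mk ((p : ℤ) • x) :=
      (map_zsmul Q.mkQ (p : ℤ) x).symm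
    rw [h1, Submodule.Quotient.mk_eq_zero, hQ]
    exact ⟨x, by rw [hπX, LinearMap.smul_apply, Module.End.one_apply]⟩
  -- `φ_X^{p^t} = 1`, `φ̄^{p^t} = 1`
  have hφXpow : ∀ (n : ℕ) (x : W), ((φX ^ n) x : M) = (φ ^ n) (x : M) := by
    intro n
    induction n with
    | zero => intro x; simp
    | succ n ih => intro x; rw [pow_succ, pow_succ, Module.End.mul_apply, Module.End.mul_apply, ih, hφX, LinearMap.restrict_apply]
  have hφXt : φX ^ (p ^ t) = 1 := by
    apply LinearMap.ext; intro x
    apply Subtype.ext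
    rw [hφXpow, hφ, Module.End.one_apply, Module.End.one_apply]
  have hφVpow : ∀ (n : ℕ) (x : W), (φV ^ n) (Submodule.Quotient.mk x) = Submodule.Quotient.mk ((φX ^ n) x) := by
    intro n
    induction n with
    | zero => intro x; rw [pow_zero, pow_zero, Module.End.one_apply, Module.End.one_apply]
    | succ n ih => intro x; rw [pow_succ, pow_succ, Module.End.mul_apply, Module.End.mul_apply, hφV, ih]
  have hφVt : φV ^ (p ^ t) = 1 := by
    apply LinearMap.ext; intro v
    obtain ⟨x, rfl⟩ := Submodule.Quotient.mk_surjective Q v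
    rw [hφVpow, hφXt, Module.End.one_apply, Module.End.one_apply]
  -- `N = φ̄ - 1` is nilpotent: `N^{p^t} = 0`
  have hNnil : (φV - 1) ^ (p ^ t) = 0 := by
    apply LinearMap.ext; intro v
    rw [LinearMap.zero_apply]
    exact sub_one_pow_apply_eq_zero p t hV φV hφVt v
  -- `#V` is a `p`-power `≤ p^r`
  haveI : Finite (W ⧸ Q) := Finite.of_surjective _ (Submodule.Quotient.mk_surjective Q)
  obtain ⟨a, ha⟩ := hM
  have hWcard : ∃ b, Nat.card W = p ^ b := by
    have hdvd : Nat.card W ∣ p ^ a := by rw [← ha]; exact AddSubgroup.card_addSubgroup_dvd_card W.toAddSubgroup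
    obtain ⟨b, -, hb⟩ := (Nat.dvd_prime_pow hp.out).mp hdvd
    exact ⟨b, hb⟩
  have hVcard : ∃ c, Nat.card (W ⧸ Q) = p ^ c := by
    obtain ⟨b, hb⟩ := hWcard
    have hdvd : Nat.card (W ⧸ Q) ∣ p ^ b := by
      rw [← hb, Submodule.card_eq_card_quotient_mul_card Q]
      exact Dvd.intro_left _ rfl
    obtain ⟨c, -, hc⟩ := (Nat.dvd_prime_pow hp.out).mp hdvd
    exact ⟨c, hc⟩
  have hVle : Nat.card (W ⧸ Q) ≤ p ^ r := (card_quotient_range_smul_le p W).trans hr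
  -- §2 on `V` with the stable subgroup `⊤`: `N^r = 0`, hence `N^{p^{k₀}} = 0`
  have hNr : ∀ v : W ⧸ Q, ((φV - 1) ^ r) v = 0 := by
    have h := pow_apply_eq_zero_of_card_le hVcard (φV - 1) ⟨p ^ t, hNnil⟩ r ⊤ (fun _ _ => Submodule.mem_top)
      (by rw [Nat.card_congr (Submodule.topEquiv (R := ℤ) (M := W ⧸ Q)).toEquiv]; exact hVle)
    exact fun v => h v Submodule.mem_top
  have hNk₀ : ∀ v : W ⧸ Q, ((φV - 1) ^ (p ^ k₀)) v = 0 := by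
    intro v
    obtain ⟨e, he⟩ := Nat.exists_eq_add_of_le hk₀
    rw [he, pow_add, Module.End.mul_apply, hNr]
  -- hence `φ̄^{p^{k₀}} = 1` on `V`, i.e. `(φ_X^{p^{k₀}} - 1) x ∈ Q`
  have hφVk₀ : ∀ v : W ⧸ Q, (φV ^ (p ^ k₀)) v = v := pow_apply_eq_self_of_sub_one_pow_apply_eq_zero p k₀ hV φV hNk₀
  intro w hw
  have h1 : (Submodule.Quotient.mk ((φX ^ (p ^ k₀)) ⟨w, hw⟩) : W ⧸ Q) = Submodule.Quotient.mk ⟨w, hw⟩ := by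
    rw [← hφVpow]; exact hφVk₀ _
  rw [← sub_eq_zero, ← Submodule.Quotient.mk_sub, Submodule.Quotient.mk_eq_zero, hQ] at h1
  obtain ⟨u, hu⟩ := h1
  refine Submodule.mem_map.mpr ⟨(u : M), u.2, ?_⟩
  have h2 := congrArg (fun y : W => (y : M)) hu
  simp only [hπX, LinearMap.smul_apply, Module.End.one_apply, Submodule.coe_sub, hφXpow] at h2
  rw [LinearMap.smul_apply, Module.End.one_apply, LinearMap.sub_apply, Module.End.one_apply, ← h2, Submodule.coe_smul]

/-! ## §5 From `(φ^{p^j} − 1)W ⊆ pW` to `(φ^{p^{j+1}} − 1)W ⊆ p²W`, and `ν W = pW` -/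

/-- A `φ`-stable subgroup is stable under every power of `φ`. [folklore] -/
private theorem pow_apply_mem {M : Type*} [AddCommGroup M] (φ : Module.End ℤ M) (W : Submodule ℤ M) (hW : ∀ w ∈ W, φ w ∈ W)
    (n : ℕ) {w : M} (hw : w ∈ W) : (φ ^ n) w ∈ W := by
  induction n generalizing w with
  | zero => simpa using hw
  | succ n ih => rw [pow_succ, Module.End.mul_apply]; exact ih (hW w hw)

/-- If `(ψ − 1)W ⊆ S` for a subgroup `S` and `W` is `ψ`-stable, then `(ψ^i − 1)W ⊆ S` for all `i` (`ψ^i − 1 = (ψ − 1)(1 + ψ + ⋯ + ψ^{i−1})`).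
[folklore] [cite: Washington1997, §13.3 Lemma 13.18 (proof)] -/
theorem pow_sub_one_apply_mem {M : Type*} [AddCommGroup M] (ψ : Module.End ℤ M) (W S : Submodule ℤ M)
    (hW : ∀ w ∈ W, ψ w ∈ W) (h : ∀ w ∈ W, (ψ - 1) w ∈ S) (i : ℕ) : ∀ w ∈ W, (ψ ^ i - 1) w ∈ S := by
  intro w hw
  have hid : ψ ^ i - 1 = (ψ - 1) * ∑ l ∈ range i, ψ ^ l := (mul_geom_sum ψ i).symm
  rw [hid, Module.End.mul_apply, LinearMap.sum_apply]
  exact h _ (W.sum_mem fun l _ => pow_apply_mem ψ W hW l hw)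

/-- **`(φ^{p^j} − 1)W ⊆ pW ⇒ (φ^{p^{j+1}} − 1)W ⊆ p²W`** for a `φ`-stable `W`: writing `ψ = φ^{p^j}`, `θ = ψ − 1`, one has
`φ^{p^{j+1}} − 1 = θ·(1 + ψ + ⋯ + ψ^{p−1})` and `1 + ψ + ⋯ + ψ^{p−1} = p + ∑_{i<p}(ψ^i − 1)` maps `W` into `pW`.
[cite: Washington1997, §13.3 (proof of Prop. 13.23)] [cite: Fukuda1994, Thm. 1 (2), p. 264] -/
theorem sub_one_apply_mem_map_map_of {M : Type*} [AddCommGroup M] {p : ℕ} (φ : Module.End ℤ M) (W : Submodule ℤ M)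
    (hW : ∀ w ∈ W, φ w ∈ W) {j : ℕ}
    (h : ∀ w ∈ W, (φ ^ (p ^ j) - 1) w ∈ W.map ((p : ℤ) • (1 : Module.End ℤ M))) :
    ∀ w ∈ W, (φ ^ (p ^ (j + 1)) - 1) w ∈ (W.map ((p : ℤ) • (1 : Module.End ℤ M))).map ((p : ℤ) • (1 : Module.End ℤ M)) := by
  set π : Module.End ℤ M := (p : ℤ) • 1 with hπ
  set ψ : Module.End ℤ M := φ ^ (p ^ j) with hψ
  have hWψ : ∀ w ∈ W, ψ w ∈ W := fun w hw => pow_apply_mem φ W hW _ hw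
  -- `(1 + ψ + ⋯ + ψ^{p-1}) w ∈ pW`
  have hΦ : ∀ w ∈ W, (∑ i ∈ range p, ψ ^ i) w ∈ W.map π := by
    intro w hw
    have h1 : (∑ i ∈ range p, ψ ^ i) w = (∑ i ∈ range p, (ψ ^ i - 1)) w + π w := by
      rw [Finset.sum_sub_distrib, LinearMap.sub_apply, Finset.sum_const, Finset.card_range, LinearMap.smul_apply,
        Module.End.one_apply, hπ, LinearMap.smul_apply, Module.End.one_apply, natCast_zsmul, sub_add_cancel]
    rw [h1, LinearMap.sum_apply]
    exact Submodule.add_mem _ (Submodule.sum_mem _ fun i _ => pow_sub_one_apply_mem ψ W _ hWψ h i w hw)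
      (Submodule.mem_map_of_mem hw)
  -- `φ^{p^{j+1}} - 1 = (∑ ψ^i) ∘ (ψ - 1)`
  intro w hw
  have hid : φ ^ (p ^ (j + 1)) - 1 = (∑ i ∈ range p, ψ ^ i) * (ψ - 1) := by
    rw [pow_succ, pow_mul, ← hψ, geom_sum_mul]
  rw [hid, Module.End.mul_apply]
  -- `(ψ - 1) w = π u` with `u ∈ W`, and `(∑ ψ^i)(π u) = π ((∑ ψ^i) u) ∈ π (pW)`
  obtain ⟨u, hu, hπu⟩ := Submodule.mem_map.mp (h w hw)
  rw [← hπu]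
  have hcomm : (∑ i ∈ range p, ψ ^ i) (π u) = π ((∑ i ∈ range p, ψ ^ i) u) := by
    rw [hπ, LinearMap.smul_apply, Module.End.one_apply, LinearMap.smul_apply, Module.End.one_apply, map_zsmul]
  rw [hcomm]
  exact Submodule.mem_map_of_mem (hΦ u hu)

/-- **`(ψ − 1)W ⊆ p²W ⇒ (1 + ψ + ⋯ + ψ^{p−1})W = pW`** for a `ψ`-stable subgroup `W` of a finite abelian `p`-group:
`∑ψ^i = p + θ·S` with `θS(W) ⊆ p²W`, so `∑ψ^i(W) ⊆ pW` and `pW ⊆ ∑ψ^i(W) + p²W ⊆ ⋯ ⊆ ∑ψ^i(W) + p^sW = ∑ψ^i(W)`.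
[cite: Washington1997, §13.3 (proof of Prop. 13.23: `ν_n` acts as `p·unit` for `n ≫ 0`)] [cite: Fukuda1994, Thm. 1 (2), p. 264] -/
theorem map_geom_sum_eq_map_smul {M : Type*} [AddCommGroup M] [Finite M] {p : ℕ}
    (hM : ∃ a : ℕ, Nat.card M = p ^ a) (ψ : Module.End ℤ M) (W : Submodule ℤ M) (hW : ∀ w ∈ W, ψ w ∈ W)
    (h : ∀ w ∈ W, (ψ - 1) w ∈ (W.map ((p : ℤ) • (1 : Module.End ℤ M))).map ((p : ℤ) • (1 : Module.End ℤ M))) :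
    W.map (∑ i ∈ range p, ψ ^ i) = W.map ((p : ℤ) • (1 : Module.End ℤ M)) := by
  set π : Module.End ℤ M := (p : ℤ) • 1 with hπ
  set Φ : Module.End ℤ M := ∑ i ∈ range p, ψ ^ i with hΦ
  have hπapp : ∀ x : M, π x = (p : ℤ) • x := fun x => by rw [hπ, LinearMap.smul_apply, Module.End.one_apply]
  -- `Φ w - π w ∈ p²W`
  have hdiff : ∀ w ∈ W, Φ w - π w ∈ (W.map π).map π := by
    intro w hw
    have h1 : Φ w - π w = (∑ i ∈ range p, (ψ ^ i - 1)) w := by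
      simp only [hΦ, hπapp, Finset.sum_sub_distrib, LinearMap.sub_apply, Finset.sum_const, Finset.card_range,
        LinearMap.smul_apply, Module.End.one_apply, natCast_zsmul]
    rw [h1, LinearMap.sum_apply]
    exact Submodule.sum_mem _ fun i _ => pow_sub_one_apply_mem ψ W _ hW h i w hw
  have hπpow : ∀ (n : ℕ) (x : M), (π ^ n) x = ((p : ℤ) ^ n) • x := by
    intro n
    induction n with
    | zero => intro x; simp
    | succ n ih => intro x; rw [pow_succ, Module.End.mul_apply, hπapp, ih, smul_smul, ← pow_succ]
  have hsmul_mem : ∀ (S : Submodule ℤ M) (n : ℕ) {x : M}, x ∈ S → (π ^ n) x ∈ S := fun S n x hx => by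
    rw [hπpow]; exact S.smul_mem _ hx
  have hp2W : (W.map π).map π ≤ W.map π := by
    rw [Submodule.map_le_iff_le_comap]
    rintro _ ⟨u, hu, rfl⟩
    rw [Submodule.mem_comap]
    exact Submodule.mem_map_of_mem (by rw [hπapp]; exact W.smul_mem _ hu)
  apply le_antisymm
  · -- `Φ W ⊆ pW`
    rw [Submodule.map_le_iff_le_comap]
    intro w hw
    rw [Submodule.mem_comap]
    have : Φ w = (Φ w - π w) + π w := by abel
    rw [this]
    exact Submodule.add_mem _ (hp2W (hdiff w hw)) (Submodule.mem_map_of_mem hw)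
  · -- `pW ⊆ Φ W + π^{s+1}(pW)` for all `s`, and `π^{a}(pW) = 0` for `#M = p^a`
    have hstep : ∀ s : ℕ, W.map π ≤ W.map Φ ⊔ (W.map π).map (π ^ (s + 1)) := by
      intro s
      induction s with
      | zero =>
        rintro _ ⟨w, hw, rfl⟩
        have : π w = Φ w + -(Φ w - π w) := by abel
        rw [this]
        refine Submodule.add_mem _ (Submodule.mem_sup_left (Submodule.mem_map_of_mem hw))
          (Submodule.mem_sup_right (Submodule.neg_mem _ ?_))
        rw [zero_add, pow_one]
        exact hdiff w hw
      | succ s ih =>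
        intro x hx
        obtain ⟨u, hu, y, hy, rfl⟩ := Submodule.mem_sup.mp (ih hx)
        refine Submodule.add_mem _ (Submodule.mem_sup_left hu) ?_
        obtain ⟨x', hx', rfl⟩ := Submodule.mem_map.mp hy
        obtain ⟨u', hu', y', hy', hxy'⟩ := Submodule.mem_sup.mp (ih hx')
        rw [← hxy', map_add]
        refine Submodule.add_mem _ (Submodule.mem_sup_left (hsmul_mem _ _ hu')) (Submodule.mem_sup_right ?_)
        obtain ⟨x'', hx'', rfl⟩ := Submodule.mem_map.mp hy'
        refine Submodule.mem_map.mpr ⟨(π ^ s) x'', hsmul_mem _ s hx'', ?_⟩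
        rw [← Module.End.mul_apply, ← pow_add, ← Module.End.mul_apply, ← pow_add,
          show s + 1 + 1 + s = s + 1 + (s + 1) by ring]
    obtain ⟨a, ha⟩ := hM
    have hzero : (W.map π).map (π ^ (a + 1)) = ⊥ := by
      rw [eq_bot_iff]
      rintro _ ⟨x, -, rfl⟩
      rw [Submodule.mem_bot, hπpow, pow_succ', mul_smul, ← Nat.cast_pow, natCast_zsmul, natCast_zsmul, ← ha,
        card_nsmul_eq_zero', smul_zero]
    have h := hstep a
    rwa [hzero, sup_bot_eq] at h

/-! ## §6 `p²W = 0 ⇒ #(pW)² ≤ #W` -/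

/-- **`p²W = 0 ⇒ #(pW)² ≤ #W`**: multiplication by `p` maps `W` onto `pW` and kills `pW`, so `#(pW) ≤ #(W/pW) = #W/#(pW)` (log-concavity
`e_{m+2} − e_{m+1} ≤ e_{m+1} − e_m` behind «`μ = 0`», finite shadow). [cite: Washington1997, §13.3 (proof of Prop. 13.23)]
[cite: Fukuda1994, Thm. 1 (2), p. 264] -/
theorem card_map_smul_sq_le {M : Type*} [AddCommGroup M] [Finite M] (p : ℕ) (W : Submodule ℤ M)
    (h : (W.map ((p : ℤ) • (1 : Module.End ℤ M))).map ((p : ℤ) • (1 : Module.End ℤ M)) = ⊥) :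
    Nat.card (W.map ((p : ℤ) • (1 : Module.End ℤ M))) ^ 2 ≤ Nat.card W := by
  classical
  set π : Module.End ℤ M := (p : ℤ) • 1 with hπ
  -- the surjection `W → pW`, `w ↦ p w`, restricted: `πW : W →ₗ W.map π`
  set πW : W →ₗ[ℤ] W.map π := (π.domRestrict W).codRestrict (W.map π) (fun w => Submodule.mem_map_of_mem w.2) with hπW
  have hsurj : Function.Surjective πW := by
    rintro ⟨y, hy⟩
    obtain ⟨w, hw, rfl⟩ := Submodule.mem_map.mp hy
    exact ⟨⟨w, hw⟩, Subtype.ext rfl⟩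
  -- its kernel contains the preimage of `pW` in `W`
  have hker : ∀ w : W, (w : M) ∈ W.map π → w ∈ LinearMap.ker πW := by
    intro w hw
    rw [LinearMap.mem_ker]
    apply Subtype.ext
    change π (w : M) = 0
    have : π (w : M) ∈ (W.map π).map π := Submodule.mem_map_of_mem hw
    rw [h, Submodule.mem_bot] at this
    exact this
  -- `#W = #ker · #(pW)` and `#ker ≥ #(pW)`
  have h1 := Submodule.card_eq_card_quotient_mul_card (LinearMap.ker πW)
  rw [Nat.card_congr (LinearMap.quotKerEquivOfSurjective πW hsurj).toEquiv] at h1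
  -- injection `pW ↪ ker πW`
  let f : W.map π → LinearMap.ker πW := fun y => ⟨⟨(y : M), Submodule.map_le_iff_le_comap.mpr
      (fun w hw => by rw [Submodule.mem_comap, hπ, LinearMap.smul_apply, Module.End.one_apply]; exact W.smul_mem _ hw) y.2⟩,
    hker _ y.2⟩
  have hf : Function.Injective f := by
    intro x y hxy
    apply Subtype.ext
    exact congrArg (fun z : LinearMap.ker πW => ((z : W) : M)) hxy
  have h2 : Nat.card (W.map π) ≤ Nat.card (LinearMap.ker πW) := Nat.card_le_card_of_injective f hf
  rw [h1, pow_two]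
  exact Nat.mul_le_mul_right _ h2

end Literature.NumberTheory.IwasawaTheory.FukudaNakayama

end
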